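import Summits.Ventures.Crystal3D.Theorems.StickyWulffConstantCoaxialWallLawPayerEndPairsMultiPlates
import Summits.Ventures.Crystal3D.Theorems.StickyWulffConstantCoaxialWallLawBarlowCoreRigidity
import Summits.Ventures.Crystal3D.Theorems.StickyWulffConstantCoaxialWallLawBarlowPlateSources
import Summits.Ventures.Crystal3D.Theorems.StickyWulffConstantCoaxialWallLawBarlowNoEntry
import Summits.Ventures.Crystal3D.Theorems.StickyWulffConstantCoaxialWallLawBarlowOneFccCellHyps
import HarnessLib

/-!
# The ONE-FCC F_layer cell: END PAIRS of the faulted BOTTOM plate's opposite-tree word net (F_layer L4 / OneFcc export)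

HONEST FRAMING. Venture `Summits/Ventures/Crystal3D` (cell `crystal3d-full`); helper `--supports` the crux `CoaxialWallLaw`
(stmt-Ventures-19481, REGISTERED line `WallLedgerF`) in its role as owner of lane T's debt T-F2 / F_layer; cf-p1 DECISION (civ):
target `FLayerTwinFamilyOneFccAt (13/25) C 10` (…TexShadowFLayerSplitDefs).  Inputs `KissingGap δ`, `KissingClassification δ` by
name; census-free; nothing about the crux is claimed; F-C1 not moved.  Memos HOME/wall-19481-p1/g15/{F-LAYER-SINKS-g15.md §4(a),
B1-…}.

THE CELL.  Bottom plate = a clamped Barlow plate `stacking L₁ s₁ σ₁` (ANY Hägg word), top plate = a clamped SIGN-CONSTANT plate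
`stacking L₂ s₂ σ₂` (`σ₂ ≡ ε`) whose balls are FULL in a frame `Gf` (`= L₂` or `basalMirror ≫ L₂`); the word net is the bottom plate's
tree over the base frame `Fr ∈ {L₁, basalMirror ≫ L₁}` OPPOSITE to the top plate's orientation (`Gf '' D₊ = Fr '' D₋`: the twin-family
hypothesis of the OneFcc cell, supplied by the assembly), rooted at the rising in-plane slots `inPlaneRoots Fr 1`.  The plate-abstract
census `word_endPairs_multi_plates` (p694150) is run at the SHIFTED constants `(R₀+1, ρ−1)` with the trivial state invariant and
* sources `hPsrc` = `hPsrc_of_plateCore_frame/_mirror` (p696624) on the core band, admissible layers `≠ (−t, −t)`;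
* core rigidity `hstd` = `hstd_of_plateCore` (p696331); top exclusion `hPexcl0` = `hPexcl0_of_fullTwinPlate` (p697004);
* sealing `hsealB` / `hP₂seal` = `sealing_below_barlow` / `sealing_above_barlow` (…BarlowOneFccCellHyps).
**`wordNet_barlow_endPairs_oneFcc`** — the pooled end pairs `T`: the RAW source count (admissible core-band balls crossing into the
window, summed over the rising in-plane roots) is at most `#T + #RT·rims`; every pair is in `X × X` at distance `1` in the window, has the
two-payer property, and is witnessed by an admissible class of the plate system `⟨Fr, inPlaneRoots Fr 1⟩` — the system `S₁` of the twin
row of record `EndRowTwinHalfTurnA` with `L := Fr` — together with the predecessor clause and `IsEndMove` (the input of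
`card_endPairs_le_of_localRow`).
WHAT THIS IS NOT: the FLUX lower bound for the source count, the rim bounds, the row discharge and the currency glue are the next files;
F-C1 not moved.
-/

noncomputable section

namespace Summit.Ventures.Crystal3D.Theorems

open Summit.Ventures.Crystal3D Finset
open Literature.MathematicalPhysics.StatisticalMechanics (barlowPos barlowStacking IsHaggSeq barlowPos_mem basalMirror
  basalMirror_apply_coord basalMirror_basalMirror)
open Summit.Ventures.Crystal3D.Cruxes.TextureLiminf.TexShadow (E3 stacking)
open scoped InnerProductSpace

open scoped Classical in
/-- **The ONE-FCC cell's bottom word net: pooled end pairs, typed export.**  See the module docstring. -/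
theorem wordNet_barlow_endPairs_oneFcc (ver : WordVersion) {δ : ℝ} (hg : KissingGap δ) (hc : KissingClassification δ)
    {σ₁ σ₂ : ℤ → ℤ} (hσ₁ : IsHaggSeq σ₁) (L₁ L₂ : E3 ≃ₗᵢ[ℝ] E3) (s₁ s₂ : E3)
    (Fr : E3 ≃ₗᵢ[ℝ] E3) {t : ℤ} (hFr : (t = 1 ∧ Fr = L₁) ∨ (t = -1 ∧ Fr = basalMirror.trans L₁))
    (Gf : E3 ≃ₗᵢ[ℝ] E3) {ε : ℤ} (hGf : (ε = 1 ∧ Gf = L₂) ∨ (ε = -1 ∧ Gf = basalMirror.trans L₂))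
    (hσ₂ : ∀ n : ℤ, σ₂ n = ε)
    (hdozen : (Gf : E3 → E3) '' ↑fccSlots = (fun x => Fr (basalMirror x)) '' ↑fccSlots)
    (X P₁ P₂ : Finset E3) (R₀ h ρ : ℝ) (hR₀ : 5 ≤ R₀) (hρ : R₀ + 2 ≤ ρ)
    (hX : ∀ p ∈ X, ∀ q ∈ X, p ≠ q → 1 ≤ dist p q) (hP₁X : P₁ ⊆ X) (hP₂X : P₂ ⊆ X)
    (hP₁ : ∀ p, p ∈ P₁ ↔ (p ∈ stacking L₁ s₁ σ₁ ∧ -(2 * R₀) ≤ p 2 ∧ p 2 ≤ -R₀ ∧ p 0 ^ 2 + p 1 ^ 2 ≤ ρ ^ 2))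
    (hP₂ : ∀ p, p ∈ P₂ ↔ (p ∈ stacking L₂ s₂ σ₂ ∧ h + R₀ ≤ p 2 ∧ p 2 ≤ h + 2 * R₀ ∧ p 0 ^ 2 + p 1 ^ 2 ≤ ρ ^ 2)) :
    ∃ T : Finset (E3 × E3),
      (∑ r ∈ inPlaneRoots Fr 1,
        ((P₁.filter fun p => -(R₀ + 1) - 1 - 1 ≤ p 2 ∧ p 2 ≤ -(R₀ + 1) - 1 ∧ p 0 ^ 2 + p 1 ^ 2 ≤ (ρ - 1 - 1) ^ 2).filter
          fun p => (∃ k i j : ℤ, p = L₁ (barlowPos 1 (Real.sqrt (2 / 3)) σ₁ k i j) + s₁ ∧ ¬ (σ₁ (k - 1) = -t ∧ σ₁ k = -t)) ∧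
            -(R₀ + 1) - 1 < (p + Fr r) 2 ∧ (p + Fr r) 2 < h + (R₀ + 1) + 1).card ≤
        T.card + (inPlaneRoots Fr 1).card *
          (220 * (X.filter fun s => h + (R₀ + 1) + 1 ≤ s 2 ∧ s 2 ≤ h + (R₀ + 1) + 1 + 1 ∧
              (ρ - 1 - 2) ^ 2 < s 0 ^ 2 + s 1 ^ 2).card +
            220 * (X.filter fun s => -(R₀ + 1) - 1 - 1 ≤ s 2 ∧ s 2 < -(R₀ + 1) - 1 ∧
              (ρ - 1 - 1) ^ 2 < s 0 ^ 2 + s 1 ^ 2).card)) ∧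
      (∀ bq ∈ T, bq.1 ∈ X ∧ bq.2 ∈ X ∧ dist bq.1 bq.2 = 1 ∧ -(R₀ + 1) - 1 ≤ bq.1 2 ∧ bq.1 2 < h + (R₀ + 1) + 1) ∧
      (∀ bq ∈ T, (X.filter fun q => dist bq.1 q = 1).card ≤ 11 ∨
        ∃ z₁ ∈ X, ∃ z₂ ∈ X, z₁ ≠ z₂ ∧ dist bq.1 z₁ = 1 ∧ dist bq.1 z₂ = 1 ∧
          (X.filter fun q => dist z₁ q = 1).card ≤ 11 ∧ (X.filter fun q => dist z₂ q = 1).card ≤ 11) ∧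
      (∀ bq ∈ T, ∃ r ∈ inPlaneRoots Fr 1, ∃ κ : List E3, WFChain r κ ∧
        bq.2 - (⟨Fr, inPlaneRoots Fr 1⟩ : PlateSystem).Fw κ (((-1 : ℝ) ^ κ.length) • r) ∈ X ∧
        IsEndMove X ver ((⟨Fr, inPlaneRoots Fr 1⟩ : PlateSystem).Fw κ)
          ((⟨Fr, inPlaneRoots Fr 1⟩ : PlateSystem).Fw κ (((-1 : ℝ) ^ κ.length) • r)) bq.2 bq.1) := by
  set RT := inPlaneRoots Fr 1 with hRTdef
  have hRT : ∀ r ∈ RT, r ∈ fccSlots := fun r hr => (mem_filter.1 hr).1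
  have hRT2 : ∀ r ∈ RT, r 2 = 0 := fun r hr => (mem_filter.1 hr).2.1
  have hRTup : ∀ r ∈ RT, 0 < (Fr r) 2 := fun r hr => by
    have := (mem_filter.1 hr).2.2; rwa [one_mul] at this
  -- the word data over the base frame `Fr`
  set Fw : List E3 → (E3 ≃ₗᵢ[ℝ] E3) := fun κ => κ.foldr (fun μ G => ((ℝ ∙ μ)ᗮ.reflection).trans G) Fr with hFw
  set uw : E3 → List E3 → E3 := fun r κ => κ.foldr (fun _ v => -v) r with huw
  set WFw : E3 → List E3 → Prop := fun r κ =>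
    List.rec (motive := fun _ => Prop) True (fun μ κ' ih => ih ∧ ‖μ‖ = 1 ∧
      (∀ w ∈ fccSlots, ⟪w, μ⟫_ℝ = 0 ∨ ⟪w, μ⟫_ℝ = Real.sqrt (2 / 3) ∨ ⟪w, μ⟫_ℝ = -Real.sqrt (2 / 3)) ∧
      ⟪uw r κ', μ⟫_ℝ = Real.sqrt (2 / 3) ∧ ∀ μ' κ'', κ' = μ' :: κ'' → μ' ≠ -μ) κ with hWFw
  set nextw : List E3 → E3 → List E3 :=
    fun κ m => @ite _ (∃ μ κ', κ = μ :: κ' ∧ (Fw κ).symm m = -μ) (Classical.propDecidable _) κ.tail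
      ((Fw κ).symm m :: κ) with hnextw
  have hF0 : Fw [] = Fr := rfl
  have hFc : ∀ μ κ, Fw (μ :: κ) = ((ℝ ∙ μ)ᗮ.reflection).trans (Fw κ) := fun _ _ => rfl
  have hu0 : ∀ r, uw r [] = r := fun _ => rfl
  have huc : ∀ r μ κ, uw r (μ :: κ) = -uw r κ := fun _ _ _ => rfl
  have hWF0 : ∀ r, WFw r [] := fun _ => trivial
  have hWFc : ∀ r μ κ, WFw r (μ :: κ) ↔ (WFw r κ ∧ ‖μ‖ = 1 ∧
      (∀ w ∈ fccSlots, ⟪w, μ⟫_ℝ = 0 ∨ ⟪w, μ⟫_ℝ = Real.sqrt (2 / 3) ∨ ⟪w, μ⟫_ℝ = -Real.sqrt (2 / 3)) ∧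
      ⟪uw r κ, μ⟫_ℝ = Real.sqrt (2 / 3) ∧ ∀ μ' κ', κ = μ' :: κ' → μ' ≠ -μ) := fun _ _ _ => Iff.rfl
  have hnext_pop : ∀ μ κ' (m : E3), (Fw (μ :: κ')).symm m = -μ → nextw (μ :: κ') m = κ' := by
    intro μ κ' m hν
    simp only [hnextw]
    rw [if_pos ⟨μ, κ', rfl, hν⟩, List.tail_cons]
  have hnext_push : ∀ κ (m : E3), (∀ μ κ', κ = μ :: κ' → (Fw κ).symm m ≠ -μ) → nextw κ m = (Fw κ).symm m :: κ := by
    intro κ m hnp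
    simp only [hnextw]
    rw [if_neg]
    rintro ⟨μ, κ', h, hν⟩
    exact hnp μ κ' h hν
  clear_value nextw WFw uw Fw
  -- the cell: clamps, core band, top band
  set W₁ : Set E3 := {x : E3 | -(2 * R₀) ≤ x 2 ∧ x 2 ≤ -R₀ ∧ x 0 ^ 2 + x 1 ^ 2 ≤ ρ ^ 2} with hW₁
  set W₂ : Set E3 := {x : E3 | h + R₀ ≤ x 2 ∧ x 2 ≤ h + 2 * R₀ ∧ x 0 ^ 2 + x 1 ^ 2 ≤ ρ ^ 2} with hW₂
  have hplate₁ : ∀ p ∈ stacking L₁ s₁ σ₁, p ∈ W₁ → p ∈ X := plate_mem_of_clamp₁ L₁ s₁ hP₁X hP₁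
  have hplate₂ : ∀ p ∈ stacking L₂ s₂ σ₂, p ∈ W₂ → p ∈ X := plate_mem_of_clamp₂ L₂ s₂ hP₂X hP₂
  set CORE := P₁.filter (fun p => -(R₀ + 1) - 1 - 1 ≤ p 2 ∧ p 2 ≤ -(R₀ + 1) - 1 ∧
    p 0 ^ 2 + p 1 ^ 2 ≤ (ρ - 1 - 1) ^ 2) with hCORE
  set TOP := P₂.filter (fun p => h + (R₀ + 1) + 1 ≤ p 2 ∧ p 2 ≤ h + (R₀ + 1) + 1 + 1 ∧
    p 0 ^ 2 + p 1 ^ 2 ≤ (ρ - 1 - 2) ^ 2) with hTOP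
  have hcore : ∀ p ∈ CORE, ∃ k i j : ℤ, p = L₁ (barlowPos 1 (Real.sqrt (2 / 3)) σ₁ k i j) + s₁ ∧
      ∀ x, dist p x ≤ 2 → x ∈ W₁ := coreBand₁_deep L₁ s₁ hP₁ hR₀ (by linarith)
  have htop : ∀ p ∈ TOP, ∃ k i j : ℤ, p = L₂ (barlowPos 1 (Real.sqrt (2 / 3)) σ₂ k i j) + s₂ ∧
      ∀ x, dist p x ≤ 2 → x ∈ W₂ := topBand₂_deep L₂ s₂ hP₂ hR₀ (by linarith)
  -- the admissibility predicate (root-free)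
  set srcOK : E3 → E3 → Prop := fun _ p =>
    ∃ k i j : ℤ, p = L₁ (barlowPos 1 (Real.sqrt (2 / 3)) σ₁ k i j) + s₁ ∧ ¬ (σ₁ (k - 1) = -t ∧ σ₁ k = -t) with hsrcOK
  -- (1) sources
  have hPsrc : ∀ r ∈ RT, ∀ p ∈ CORE, srcOK r p → p ∈ X ∧
      (∃ a ∈ fccSlots, ∃ a' ∈ fccSlots, ∃ a'' ∈ fccSlots,
        ⟪a, a'⟫_ℝ = 1 / 2 ∧ ⟪a, a''⟫_ℝ = 1 / 2 ∧ ⟪a', a''⟫_ℝ = 1 / 2 ∧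
        p + Fw [] a ∈ X ∧ p + Fw [] a' ∈ X ∧ p + Fw [] a'' ∈ X) ∧
      p - Fw [] r ∈ X ∧
      (IsFull X (Fw []) p ∨ (∃ m, IsTwinReading X (Fw []) m p ∧ ⟪Fw [] r, m⟫_ℝ = 0) ∨
        (ver = WordVersion.v2 ∧ IsNarrow X (Fw []) (Fw [] r) p)) ∧
      (fun (_ : E3) (_ : E3 × List E3) => True) r (p + Fw [] r, []) := by
    intro r hr
    rcases hFr with ⟨ht, hFrL⟩ | ⟨ht, hFrL⟩
    · refine hPsrc_of_plateCore_frame hσ₁ L₁ s₁ hX hplate₁ ver (hRT r hr) (hRT2 r hr) CORE (srcOK r)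
        (P := fun _ => True) (by rw [hF0, hFrL]) ?_ (fun _ _ _ => trivial)
      intro p hp hok
      obtain ⟨k, i, j, hpk, hsg⟩ := hok
      obtain ⟨-, -, -, -, hball⟩ := hcore p hp
      refine ⟨k, i, j, hpk, hball, ?_⟩
      rw [ht] at hsg; simpa using hsg
    · refine hPsrc_of_plateCore_mirror hσ₁ L₁ s₁ hX hplate₁ ver (hRT r hr) (hRT2 r hr) CORE (srcOK r)
        (P := fun _ => True) (by rw [hF0, hFrL]) ?_ (fun _ _ _ => trivial)
      intro p hp hok
      obtain ⟨k, i, j, hpk, hsg⟩ := hok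
      obtain ⟨-, -, -, -, hball⟩ := hcore p hp
      refine ⟨k, i, j, hpk, hball, ?_⟩
      rw [ht] at hsg; simpa using hsg
  -- (2) core rigidity
  have hstd : ∀ r ∈ RT, ∀ κ, WFw r κ → ∀ p ∈ CORE, (∃ a ∈ fccSlots, ∃ a' ∈ fccSlots, ∃ a'' ∈ fccSlots,
        ⟪a, a'⟫_ℝ = 1 / 2 ∧ ⟪a, a''⟫_ℝ = 1 / 2 ∧ ⟪a', a''⟫_ℝ = 1 / 2 ∧
        p + Fw κ a ∈ X ∧ p + Fw κ a' ∈ X ∧ p + Fw κ a'' ∈ X) → Fw κ (uw r κ) = Fw [] r := by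
    intro r hr κ hκ p hp hface
    have key : Fw κ (uw r κ) = Fw [] (uw r []) := by
      rcases hFr with ⟨-, hFrL⟩ | ⟨-, hFrL⟩
      · exact hstd_of_plateCore hσ₁ L₁ s₁ hX hplate₁ ⟨LinearIsometryEquiv.refl ℝ E3, RT⟩
          PlateSystem.standardPair_refl hFc (by rw [hF0, hFrL]; rfl) (hRT2 r hr) (hu0 r) (huc r) (hWFc r) CORE
          hcore κ hκ p hp hface
      · exact hstd_of_plateCore hσ₁ L₁ s₁ hX hplate₁ ⟨basalMirror, RT⟩
          PlateSystem.standardPair_basalMirror hFc (by rw [hF0, hFrL]) (hRT2 r hr) (hu0 r) (huc r) (hWFc r) CORE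
          hcore κ hκ p hp hface
    rw [key, hu0]
  -- (3) top exclusion: the top band is FULL in `Gf`, whose dozen is the basal twin of the root dozen
  have hTOPfull : ∀ b ∈ TOP, IsFull X Gf b := by
    intro b hb
    obtain ⟨k, i, j, rfl, hW⟩ := htop b hb
    rcases hGf with ⟨hε, hG⟩ | ⟨hε, hG⟩
    · rw [hG]; exact isFull_plateBall L₂ s₂ hX hplate₂ k i j hW (by rw [hσ₂, hε]) (by rw [hσ₂, hε])
    · rw [hG]; exact isFull_mirror_plateBall L₂ s₂ hX hplate₂ k i j hW (by rw [hσ₂, hε]) (by rw [hσ₂, hε])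
  have hdozen' : (Gf : E3 → E3) '' ↑fccSlots = (fun x => Fw [] (basalMirror x)) '' ↑fccSlots := by rw [hF0]; exact hdozen
  have hPexcl0 : ∀ r ∈ RT, ∀ (b : E3) (κ : List E3), WFw r κ →
      (fun (_ : E3) (_ : E3 × List E3) => True) r (b, κ) → b ∈ TOP →
      (∃ a ∈ fccSlots, ∃ a' ∈ fccSlots, ∃ a'' ∈ fccSlots,
        ⟪a, a'⟫_ℝ = 1 / 2 ∧ ⟪a, a''⟫_ℝ = 1 / 2 ∧ ⟪a', a''⟫_ℝ = 1 / 2 ∧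
        b + Fw κ a ∈ X ∧ b + Fw κ a' ∈ X ∧ b + Fw κ a'' ∈ X) → False :=
    fun r hr => hPexcl0_of_fullTwinPlate hX hFc (huc r) (hWFc r) (by rw [hu0]; exact hRT2 r hr) Gf hdozen' hTOPfull
      (fun _ => True)
  -- (4) sealing
  have hsealB := sealing_below_barlow L₁ s₁ hX hP₁X hP₁ (R₀ := R₀) (ρ := ρ) (by linarith) (by linarith)
  have hP₂seal := sealing_above_barlow L₂ s₂ hX hP₂X hP₂ (R₀ := R₀) (h := h) (ρ := ρ) (by linarith) (by linarith)
  -- (5) the census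
  have hup : ∀ r ∈ RT, 0 < (Fw [] r) 2 := fun r hr => by rw [hF0]; exact hRTup r hr
  have hP'top : ∀ p ∈ CORE, p 2 ≤ -(R₀ + 1) - 1 := fun p hp => (mem_filter.1 hp).2.2.1
  obtain ⟨T, hkey, hTpair, hTpay, hTwit⟩ := word_endPairs_multi_plates ver (F := Fw) (u := uw) (WF := WFw)
    (next := nextw) (P := fun _ _ => True) hg hc hX hFc RT hRT (fun r _ => hu0 r) (fun r _ => huc r)
    (fun r _ => hWF0 r) (fun r _ => hWFc r) hnext_pop hnext_push (fun _ _ _ _ _ _ _ => trivial)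
    (fun _ _ _ _ _ _ _ _ _ _ => trivial) hPexcl0 hup (by linarith : (3 : ℝ) ≤ R₀ + 1) (by linarith : R₀ + 1 ≤ ρ - 1)
    srcOK hP'top hPsrc hstd hsealB hP₂seal
  rw [hF0] at hkey
  -- (6) the witnesses in the plate-system form
  set S : PlateSystem := ⟨Fr, RT⟩ with hS
  have hFwS : ∀ κ, Fw κ = S.Fw κ := by
    intro κ
    induction κ with
    | nil => rw [hF0]; rfl
    | cons μ κ ih => rw [hFc, ih]; rfl
  refine ⟨T, hkey, hTpair, hTpay, ?_⟩
  intro bq hbq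
  obtain ⟨r, hr, -, κ, hκ, hpred, hmove⟩ := hTwit bq hbq
  have hWF : WFChain r κ := wfChain_of_wf (hu0 r) (huc r) (hWFc r) κ hκ
  have hu : uw r κ = ((-1 : ℝ) ^ κ.length) • r := word_u_eq_pow_root (hu0 r) (huc r) κ
  rw [hu, hFwS] at hpred hmove
  exact ⟨r, hr, κ, hWF, hpred, hmove⟩

end Summit.Ventures.Crystal3D.Theorems

end
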